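import Mathlib
import HarnessLib
import Summits.ValiantsHypothesis.ValiantsHypothesis.Theses.MonotoneRestoration
import Literature.Computability.AlgebraicComplexity.ArithCircuit
import Literature.Computability.AlgebraicComplexity.ArithCircuitProofs
import Literature.Computability.AlgebraicComplexity.MonotoneStructure
import Literature.Computability.AlgebraicComplexity.PermanentIrreducible
import Literature.ModelTheory.FiniteModelTheory.CkEquiv
import Summits.ValiantsHypothesis.ValiantsHypothesis.Theorems.MonotoneRestorationMonotoneRestorationQPCosetCount
import Summits.ValiantsHypothesis.ValiantsHypothesis.Theorems.MonotoneRestorationMonotoneRestorationQPSymmetricLB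
import Summits.ValiantsHypothesis.ValiantsHypothesis.Theorems.MonotoneRestorationMonotoneRestorationQPSupportSymmetrisation
import Summits.ValiantsHypothesis.ValiantsHypothesis.Theorems.MonotoneRestorationMonotoneRestorationQPSparseRegime
import Summits.ValiantsHypothesis.ValiantsHypothesis.Theorems.MonotoneRestorationMonotoneRestorationQPBeta
import Literature.Computability.AlgebraicComplexity.SymmetricArithCircuit
import Literature.Computability.AlgebraicComplexity.DawarWilsenach2025Proofs
import Literature.GroupTheory.PermutationGroups.SmallIndexSubgroups
import Summits.ValiantsHypothesis.ValiantsHypothesis.Theorems.MonotoneRestorationQP.Negative.LoadBearing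
import Summits.ValiantsHypothesis.ValiantsHypothesis.Theorems.MonotoneRestorationMonotoneRestorationQPPermSupportCount

/-! TTRL-lite variant V19302 of stmt-ValiantsHypothesis-15886 -/

-- `ValiantsHypothesis.ValiantsHypothesis`: the D-0017 layout repeats the problem name in the path.
set_option linter.dupNamespace false

namespace Summit.ValiantsHypothesis.ValiantsHypothesis.Theorems

open Summit.ValiantsHypothesis.ValiantsHypothesis.Theses.MonotoneRestoration
open Literature.Computability.AlgebraicComplexity

/-- TTRL-lite variant V19302 of the registered stub `stub_gammaArithmetic` of
`stmt-ValiantsHypothesis-15886` (the inductive growth step `[G0]/[G0x]`): if `2 d ≤ m` then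
`(m + 1) ^ d ≤ 2 · m ^ d`, i.e. `(1 + 1/m) ^ d ≤ 2`.  Integer Bernoulli-type proof: the
auxiliary bound `(m + 1) ^ k · j ≤ (j + k) · m ^ k` for `j + k ≤ m` is proved by induction on
`k` (generalising `j`; the step only needs `(m + 1) j ≤ (j + 1) m`, i.e. `j ≤ m`), and the claim
is its instance `k = j = d` after cancelling the factor `d` (the case `d = 0` is trivial).
[folklore] -/
theorem stub_gammaArithmetic_var19302 :
    ∀ (d m : ℕ), 2 * d ≤ m → (m + 1) ^ d ≤ 2 * m ^ d := by
  -- Auxiliary telescoping bound, by induction on the exponent `k`.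
  have aux : ∀ k j m : ℕ, j + k ≤ m → (m + 1) ^ k * j ≤ (j + k) * m ^ k := by
    intro k
    induction k with
    | zero => intro j m _; simp
    | succ k ih =>
      intro j m h
      have h1 : (m + 1) ^ k * (j + 1) ≤ (j + 1 + k) * m ^ k := ih (j + 1) m (by omega)
      have h2 : (m + 1) * j ≤ (j + 1) * m := by nlinarith
      calc (m + 1) ^ (k + 1) * j = (m + 1) ^ k * ((m + 1) * j) := by ring
        _ ≤ (m + 1) ^ k * ((j + 1) * m) := Nat.mul_le_mul_left _ h2
        _ = (m + 1) ^ k * (j + 1) * m := by ring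
        _ ≤ (j + 1 + k) * m ^ k * m := Nat.mul_le_mul_right _ h1
        _ = (j + (k + 1)) * m ^ (k + 1) := by ring
  intro d m h
  rcases Nat.eq_zero_or_pos d with hd | hd
  · subst hd; simp
  · have h3 : (m + 1) ^ d * d ≤ 2 * m ^ d * d :=
      calc (m + 1) ^ d * d ≤ (d + d) * m ^ d := aux d d m (by omega)
        _ = 2 * m ^ d * d := by ring
    exact Nat.le_of_mul_le_mul_right h3 hd

end Summit.ValiantsHypothesis.ValiantsHypothesis.Theorems
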